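import Mathlib
import Literature.Analysis.Calculus.TwoVariablePartials
import Literature.Analysis.PDE.Wave1DFarEnergyLimits

/-!
# Kernel-one far channels, VIII: subtracting a finite-energy static solution

Helper file for `stub_kernelOneChannels` of line `crum-peeling-recessive-tower` (crux
`UniformPhotonSphereChannelsR`, stmt-FinalStateConjecture-14074).  Let `φ, S ∈ C²(ℝ²)` solve
`□ψ + Vψ = 0` on `{x ≥ x_f}` (`V ≥ 0` continuous) with finite initial far energies, `S` static
(`S(t,·) = S(0,·)`), and `ψ = φ − S`.  Then

* `energyDensity_sub_le` — pointwise `e[ψ] ≤ (3/2) e[φ] + 3 e[S]`;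
* `lintegral_energy_sub_lt_top` — `ψ` has finite initial far energy;
* `static_farEnergy_tendsto_zero` — the far energy of `S` tends to `0` along any time filter on
  which `|t| → ∞` (a finite-energy static solution radiates nothing);
* `farLimit_sub_le` — consequently far-energy limits satisfy `L[ψ] ≤ (3/2) L[φ]`.

(The constant `3/2` instead of `1` spares a square-root (Minkowski) argument; the kernel-one
estimate has exactly this much slack: `(3/4)/(3/2) = 1/2`.)
-/

noncomputable section

-- the doubled `FinalStateConjecture.FinalStateConjecture` path component trips dupNamespace
set_option linter.dupNamespace false

namespace Summit.FinalStateConjecture.FinalStateConjecture.Theorems.CrumPeelingRecessiveTower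

open MeasureTheory Set Filter Topology Literature.Analysis.Calculus Literature.Analysis.PDE

variable {V : ℝ → ℝ} {φ S ψ : ℝ → ℝ → ℝ} {xf : ℝ}

/-- The residual `ψ_tt − ψ_xx + Vψ` of a `C²` function (`V` continuous) is jointly continuous
(local copy, to keep this file independent of its siblings). -/
theorem continuous_residual' (hV : Continuous V) (hψ : ContDiff ℝ 2 (Function.uncurry ψ)) :
    Continuous (Function.uncurry fun t x =>
      iteratedDeriv 2 (fun τ => ψ τ x) t - iteratedDeriv 2 (ψ t) x + V x * ψ t x) := by
  obtain ⟨-, -, ψtt, -, ψxx, -, -, hctt, -, hcxx, -, -, -, -, -, -, h7, h8⟩ :=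
    exists_partials_of_contDiff_two hψ
  have : (Function.uncurry fun t x =>
      iteratedDeriv 2 (fun τ => ψ τ x) t - iteratedDeriv 2 (ψ t) x + V x * ψ t x)
      = fun p : ℝ × ℝ => ψtt p.1 p.2 - ψxx p.1 p.2 + V p.2 * ψ p.1 p.2 := by
    funext p; simp only [Function.uncurry, h7, h8]
  rw [this]
  exact (hctt.sub hcxx).add ((hV.comp continuous_snd).mul hψ.continuous)

/-- Tails of a finite initial far energy vanish: `∫_{x > x_f + T} e(0,·) → 0` as `T → ∞`
(for a `C²` function solving the equation on `{x ≥ x_f}`, `V ≥ 0` continuous). -/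
theorem tendsto_tail_energy_zero' (hV : Continuous V) (hV0 : ∀ x, 0 ≤ V x)
    (hψ : ContDiff ℝ 2 (Function.uncurry ψ))
    (hsol : ∀ τ x, xf ≤ x →
      iteratedDeriv 2 (fun σ => ψ σ x) τ - iteratedDeriv 2 (ψ τ) x + V x * ψ τ x = 0)
    (hfin : ∫⁻ x in Ioi xf, ENNReal.ofReal
      (deriv (fun τ => ψ τ x) 0 ^ 2 + deriv (ψ 0) x ^ 2 + V x * ψ 0 x ^ 2) < ⊤) :
    Tendsto (fun T => ∫ x in Ioi (xf + T),
      (deriv (fun τ => ψ τ x) 0 ^ 2 + deriv (ψ 0) x ^ 2 + V x * ψ 0 x ^ 2)) atTop (𝓝 0) := by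
  have hint : IntegrableOn
      (fun x => deriv (fun τ => ψ τ x) 0 ^ 2 + deriv (ψ 0) x ^ 2 + V x * ψ 0 x ^ 2) (Ioi xf) := by
    simpa using (wave1D_farEnergy_integrableOn hV hV0 (continuous_residual' hV hψ) hψ
      (fun t x => rfl) hsol hfin 0).1
  have hanti : Antitone fun T : ℝ => Ioi (xf + T) := fun a b hab => Ioi_subset_Ioi (by linarith)
  have h := tendsto_setIntegral_of_antitone (μ := volume)
    (f := fun x => deriv (fun τ => ψ τ x) 0 ^ 2 + deriv (ψ 0) x ^ 2 + V x * ψ 0 x ^ 2)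
    (fun T => measurableSet_Ioi) hanti ⟨0, by simpa using hint⟩
  have hempty : (⋂ T : ℝ, Ioi (xf + T)) = ∅ := by
    ext x
    simp only [mem_iInter, mem_Ioi, mem_empty_iff_false, iff_false, not_forall, not_lt]
    exact ⟨x - xf, by linarith⟩
  rw [hempty, Measure.restrict_empty, integral_zero_measure] at h
  exact h

/-- Slices of a global `C²` function are differentiable. -/
theorem differentiableAt_slices (hφ : ContDiff ℝ 2 (Function.uncurry φ)) (t x : ℝ) :
    DifferentiableAt ℝ (fun τ => φ τ x) t ∧ DifferentiableAt ℝ (φ t) x :=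
  ⟨((hφ.comp (contDiff_id.prodMk contDiff_const)).differentiable (by norm_num)) t,
    ((hφ.comp (contDiff_const.prodMk contDiff_id)).differentiable (by norm_num)) x⟩

/-- **Pointwise splitting** `e[φ − S] ≤ (3/2) e[φ] + 3 e[S]` of the energy density (`V ≥ 0`). -/
theorem energyDensity_sub_le (hV0 : ∀ x, 0 ≤ V x) (hφ : ContDiff ℝ 2 (Function.uncurry φ))
    (hS : ContDiff ℝ 2 (Function.uncurry S)) (hψ : ψ = fun t x => φ t x - S t x) (t x : ℝ) :
    deriv (fun τ => ψ τ x) t ^ 2 + deriv (ψ t) x ^ 2 + V x * ψ t x ^ 2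
      ≤ 3 / 2 * (deriv (fun τ => φ τ x) t ^ 2 + deriv (φ t) x ^ 2 + V x * φ t x ^ 2)
        + 3 * (deriv (fun τ => S τ x) t ^ 2 + deriv (S t) x ^ 2 + V x * S t x ^ 2) := by
  obtain ⟨d1, d3⟩ := differentiableAt_slices hφ t x
  obtain ⟨d2, d4⟩ := differentiableAt_slices hS t x
  have e1 : deriv (fun τ => ψ τ x) t = deriv (fun τ => φ τ x) t - deriv (fun τ => S τ x) t := by
    rw [hψ]; exact deriv_fun_sub d1 d2
  have e2 : deriv (ψ t) x = deriv (φ t) x - deriv (S t) x := by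
    rw [hψ]; exact deriv_fun_sub d3 d4
  have e3 : ψ t x = φ t x - S t x := by rw [hψ]
  rw [e1, e2, e3]
  have hv := hV0 x
  nlinarith [sq_nonneg (deriv (fun τ => φ τ x) t + 2 * deriv (fun τ => S τ x) t),
    sq_nonneg (deriv (φ t) x + 2 * deriv (S t) x),
    mul_nonneg hv (sq_nonneg (φ t x + 2 * S t x))]

/-- **Finite far energy of the difference.** -/
theorem lintegral_energy_sub_lt_top (hV : Continuous V) (hV0 : ∀ x, 0 ≤ V x)
    (hφ : ContDiff ℝ 2 (Function.uncurry φ)) (hS : ContDiff ℝ 2 (Function.uncurry S))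
    (hψ : ψ = fun t x => φ t x - S t x)
    (hφfin : ∫⁻ x in Ioi xf, ENNReal.ofReal
      (deriv (fun τ => φ τ x) 0 ^ 2 + deriv (φ 0) x ^ 2 + V x * φ 0 x ^ 2) < ⊤)
    (hSfin : ∫⁻ x in Ioi xf, ENNReal.ofReal
      (deriv (fun τ => S τ x) 0 ^ 2 + deriv (S 0) x ^ 2 + V x * S 0 x ^ 2) < ⊤) :
    ∫⁻ x in Ioi xf, ENNReal.ofReal
      (deriv (fun τ => ψ τ x) 0 ^ 2 + deriv (ψ 0) x ^ 2 + V x * ψ 0 x ^ 2) < ⊤ := by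
  set eφ : ℝ → ℝ := fun x => deriv (fun τ => φ τ x) 0 ^ 2 + deriv (φ 0) x ^ 2 + V x * φ 0 x ^ 2
    with heφ
  set eS : ℝ → ℝ := fun x => deriv (fun τ => S τ x) 0 ^ 2 + deriv (S 0) x ^ 2 + V x * S 0 x ^ 2
    with heS
  have mφ : Measurable fun x => ENNReal.ofReal (eφ x) :=
    ((continuous_wave1D_energyDensity hV hφ).comp
      (continuous_const.prodMk continuous_id)).measurable.ennreal_ofReal
  have hpt : ∀ x, ENNReal.ofReal (deriv (fun τ => ψ τ x) 0 ^ 2 + deriv (ψ 0) x ^ 2 + V x * ψ 0 x ^ 2)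
      ≤ ENNReal.ofReal (3 / 2) * ENNReal.ofReal (eφ x) + ENNReal.ofReal 3 * ENNReal.ofReal (eS x) := by
    intro x
    have h := energyDensity_sub_le hV0 hφ hS hψ 0 x
    have h0φ : 0 ≤ eφ x := wave1D_energyDensity_nonneg hV0 0 x
    have h0S : 0 ≤ eS x := wave1D_energyDensity_nonneg hV0 0 x
    rw [← ENNReal.ofReal_mul (by norm_num), ← ENNReal.ofReal_mul (by norm_num),
      ← ENNReal.ofReal_add (by positivity) (by positivity)]
    exact ENNReal.ofReal_le_ofReal h
  calc ∫⁻ x in Ioi xf, ENNReal.ofReal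
        (deriv (fun τ => ψ τ x) 0 ^ 2 + deriv (ψ 0) x ^ 2 + V x * ψ 0 x ^ 2)
      ≤ ∫⁻ x in Ioi xf, (ENNReal.ofReal (3 / 2) * ENNReal.ofReal (eφ x)
          + ENNReal.ofReal 3 * ENNReal.ofReal (eS x)) := lintegral_mono hpt
    _ = ENNReal.ofReal (3 / 2) * (∫⁻ x in Ioi xf, ENNReal.ofReal (eφ x))
          + ENNReal.ofReal 3 * ∫⁻ x in Ioi xf, ENNReal.ofReal (eS x) := by
        rw [lintegral_add_left (mφ.const_mul _), lintegral_const_mul _ mφ,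
          lintegral_const_mul' _ _ ENNReal.ofReal_ne_top]
    _ < ⊤ := ENNReal.add_lt_top.2 ⟨ENNReal.mul_lt_top ENNReal.ofReal_lt_top hφfin,
          ENNReal.mul_lt_top ENNReal.ofReal_lt_top hSfin⟩

/-- The energy density of a static function does not depend on time. -/
theorem static_energyDensity_eq (hstat : ∀ t x, S t x = S 0 x) (t x : ℝ) :
    deriv (fun τ => S τ x) t ^ 2 + deriv (S t) x ^ 2 + V x * S t x ^ 2
      = deriv (fun τ => S τ x) 0 ^ 2 + deriv (S 0) x ^ 2 + V x * S 0 x ^ 2 := by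
  have h1 : (fun τ => S τ x) = fun _ => S 0 x := funext fun τ => hstat τ x
  have h2 : S t = S 0 := funext fun y => hstat t y
  rw [h1, h2]
  simp

section Limits

variable (hV : Continuous V) (hV0 : ∀ x, 0 ≤ V x)
  (hφ : ContDiff ℝ 2 (Function.uncurry φ))
  (hφsol : ∀ τ x, xf ≤ x →
    iteratedDeriv 2 (fun σ => φ σ x) τ - iteratedDeriv 2 (φ τ) x + V x * φ τ x = 0)
  (hφfin : ∫⁻ x in Ioi xf, ENNReal.ofReal
    (deriv (fun τ => φ τ x) 0 ^ 2 + deriv (φ 0) x ^ 2 + V x * φ 0 x ^ 2) < ⊤)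
  (hS : ContDiff ℝ 2 (Function.uncurry S))
  (hSsol : ∀ τ x, xf ≤ x →
    iteratedDeriv 2 (fun σ => S σ x) τ - iteratedDeriv 2 (S τ) x + V x * S τ x = 0)
  (hSfin : ∫⁻ x in Ioi xf, ENNReal.ofReal
    (deriv (fun τ => S τ x) 0 ^ 2 + deriv (S 0) x ^ 2 + V x * S 0 x ^ 2) < ⊤)
  (hstat : ∀ t x, S t x = S 0 x)

include hV hV0 hS hSsol hSfin hstat in
/-- **A finite-energy static solution radiates nothing**: its far energy tends to `0` along any
time filter on which `|t| → ∞`. -/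
theorem static_farEnergy_tendsto_zero {l : Filter ℝ} (hl : Tendsto (fun t : ℝ => |t|) l atTop) :
    Tendsto (fun t => ∫ x in Ioi (xf + |t|),
      (deriv (fun τ => S τ x) t ^ 2 + deriv (S t) x ^ 2 + V x * S t x ^ 2)) l (𝓝 0) := by
  have h := (tendsto_tail_energy_zero' hV hV0 hS hSsol hSfin).comp hl
  refine h.congr fun t => ?_
  simp only [Function.comp, static_energyDensity_eq hstat]

include hV hV0 hφ hφsol hφfin hS hSsol hSfin hstat in
/-- **Far-energy limits after subtracting a finite-energy static solution**: with `ψ = φ − S`,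
along a time filter with `|t| → ∞`, `lim E[ψ] ≤ (3/2) lim E[φ]`. -/
theorem farLimit_sub_le (hψ : ψ = fun t x => φ t x - S t x) {l : Filter ℝ} [l.NeBot]
    (hl : Tendsto (fun t : ℝ => |t|) l atTop) {L Lφ : ℝ}
    (hL : Tendsto (fun t => ∫ x in Ioi (xf + |t|),
      (deriv (fun τ => ψ τ x) t ^ 2 + deriv (ψ t) x ^ 2 + V x * ψ t x ^ 2)) l (𝓝 L))
    (hLφ : Tendsto (fun t => ∫ x in Ioi (xf + |t|),
      (deriv (fun τ => φ τ x) t ^ 2 + deriv (φ t) x ^ 2 + V x * φ t x ^ 2)) l (𝓝 Lφ)) :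
    L ≤ 3 / 2 * Lφ := by
  have hVc : Continuous V := hV
  have hψC : ContDiff ℝ 2 (Function.uncurry ψ) := by rw [hψ]; exact hφ.sub hS
  have hψsol : ∀ τ x, xf ≤ x →
      iteratedDeriv 2 (fun σ => ψ σ x) τ - iteratedDeriv 2 (ψ τ) x + V x * ψ τ x = 0 := by
    intro τ x hx
    have c1 : ContDiff ℝ 2 fun σ => φ σ x := hφ.comp (contDiff_id.prodMk contDiff_const)
    have c2 : ContDiff ℝ 2 fun σ => S σ x := hS.comp (contDiff_id.prodMk contDiff_const)
    have c3 : ContDiff ℝ 2 (φ τ) := hφ.comp (contDiff_const.prodMk contDiff_id)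
    have c4 : ContDiff ℝ 2 (S τ) := hS.comp (contDiff_const.prodMk contDiff_id)
    have e1 : iteratedDeriv 2 (fun σ => ψ σ x) τ
        = iteratedDeriv 2 (fun σ => φ σ x) τ - iteratedDeriv 2 (fun σ => S σ x) τ := by
      rw [hψ]; exact iteratedDeriv_fun_sub (n := 2) c1.contDiffAt c2.contDiffAt
    have e2 : iteratedDeriv 2 (ψ τ) x = iteratedDeriv 2 (φ τ) x - iteratedDeriv 2 (S τ) x := by
      rw [hψ]; exact iteratedDeriv_fun_sub (n := 2) c3.contDiffAt c4.contDiffAt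
    have e3 : ψ τ x = φ τ x - S τ x := by rw [hψ]
    rw [e1, e2, e3]
    have h1 := hφsol τ x hx
    have h2 := hSsol τ x hx
    linarith
  have hψfin := lintegral_energy_sub_lt_top (xf := xf) hVc hV0 hφ hS hψ hφfin hSfin
  -- integrability at every time
  have iψ := fun t => (wave1D_farEnergy_integrableOn hVc hV0 (continuous_residual' hVc hψC) hψC
    (fun t x => rfl) hψsol hψfin t).1
  have iφ := fun t => (wave1D_farEnergy_integrableOn hVc hV0 (continuous_residual' hVc hφ) hφ
    (fun t x => rfl) hφsol hφfin t).1
  have iS := fun t => (wave1D_farEnergy_integrableOn hVc hV0 (continuous_residual' hVc hS) hS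
    (fun t x => rfl) hSsol hSfin t).1
  -- the comparison at every time
  have hcmp : ∀ t, (∫ x in Ioi (xf + |t|),
      (deriv (fun τ => ψ τ x) t ^ 2 + deriv (ψ t) x ^ 2 + V x * ψ t x ^ 2))
      ≤ 3 / 2 * (∫ x in Ioi (xf + |t|),
          (deriv (fun τ => φ τ x) t ^ 2 + deriv (φ t) x ^ 2 + V x * φ t x ^ 2))
        + 3 * ∫ x in Ioi (xf + |t|),
          (deriv (fun τ => S τ x) t ^ 2 + deriv (S t) x ^ 2 + V x * S t x ^ 2) := by
    intro t
    rw [← MeasureTheory.integral_const_mul, ← MeasureTheory.integral_const_mul,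
      ← integral_add ((iφ t).const_mul _) ((iS t).const_mul _)]
    exact setIntegral_mono_on (iψ t) (((iφ t).const_mul _).add ((iS t).const_mul _))
      measurableSet_Ioi fun x _ => energyDensity_sub_le hV0 hφ hS hψ t x
  have h0 := static_farEnergy_tendsto_zero hV hV0 hS hSsol hSfin hstat hl
  have hR := (hLφ.const_mul (3 / 2)).add (h0.const_mul 3)
  rw [mul_zero, add_zero] at hR
  exact le_of_tendsto_of_tendsto' hL hR hcmp

end Limits

/-- Registered form of `energyDensity_sub_le` (sub-goal `stub_kernelOneCompare` of the crux
item). -/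
theorem stub_kernelOneCompare : ∀ (V : ℝ → ℝ) (φ S ψ : ℝ → ℝ → ℝ), (∀ x, 0 ≤ V x) →
    ContDiff ℝ 2 (Function.uncurry φ) → ContDiff ℝ 2 (Function.uncurry S) →
    (ψ = fun t x => φ t x - S t x) → ∀ (t x : ℝ),
    deriv (fun τ => ψ τ x) t ^ 2 + deriv (ψ t) x ^ 2 + V x * ψ t x ^ 2
      ≤ 3 / 2 * (deriv (fun τ => φ τ x) t ^ 2 + deriv (φ t) x ^ 2 + V x * φ t x ^ 2)
        + 3 * (deriv (fun τ => S τ x) t ^ 2 + deriv (S t) x ^ 2 + V x * S t x ^ 2) :=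
  fun _ _ _ _ hV0 hφ hS hψ t x => energyDensity_sub_le hV0 hφ hS hψ t x

end Summit.FinalStateConjecture.FinalStateConjecture.Theorems.CrumPeelingRecessiveTower
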